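import Summits.Ventures.LatticeQCDFlow.Scaling.SimulatedTemperingAcceptance

/-!
HONEST FRAMING: exact (Metropolis-corrected) sampling algorithms for lattice gauge theory; figures
of merit are autocorrelation/cost numbers at stated couplings and volumes; no continuum-physics
claim.

# SimulatedTemperingTarget — THE SIMULATED-TEMPERING (EXPANDED-ENSEMBLE) TARGET WITH EXACT WEIGHTS ON
# `Fin (K+1) × Ω`, AND THE EXACT-WEIGHT NEAREST-NEIGHBOUR LEVEL-MOVE RATIOS (lean-2 GEN-13, ours)

Venture-side (OURS).  Cell `lqcd-flow` (pub-lqcd), unit `pub-lqcd-lean-2-g13`, 2026-08-23.  The objects of the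
level-autocorrelation law of simulated tempering (`Scaling/SimulatedTemperingLevelLaw`,
`Scaling/SimulatedTemperingDiffusive`): GEN-11's `Scaling/SimulatedTemperingAcceptance` priced ONE level move of
simulated tempering / the expanded ensemble (Marinari–Parisi 1992; Lyubartsev et al. 1992) with exact
free-energy weights between parameters `s → t` of the exponential family `μ_u = μ.tilted(u·X)` (acceptance
`= ∫ min(p_s, p_t) dμ`, `p_u = e^{uX}/mgf(u)`); here the JOINT state space is typed, following row 13's
two-level `Exactness/NCMCGeneralSpaceKernel.jointWeight` (`Bool × Ω`) with `K + 1` levels.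

## What is defined / proved (`μ` probability on `Ω`, `X` bounded measurable, levels `β : ℕ → ℝ`, `K : ℕ`)

* **`stTarget X μ β K`** `= (K+1)⁻¹·Σ_{k ≤ K} δ_k ⊗ μ_{β_k}`, a measure on `Fin (K+1) × Ω`: every level equally
  visited (the signature of EXACT weights `c_k = 1/Z(β_k)`), the configuration at level `k` distributed as
  `μ_{β_k}`; `integral_stTarget` (`∫ g dπ = (K+1)⁻¹Σ_k ∫ g(k,·) dμ_{β_k}`), `isProbabilityMeasure_stTarget`,
  `measurable_stLevel`, `stTarget_real_level` (`π{level = k} = 1/(K+1)`).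
* **`stLevelMoveRatio X μ β K (k, x)`** `= 1[k<K]·min(1, p_{β_{k+1}}(x)/p_{β_k}(x)) + 1[k≥1]·min(1, p_{β_{k−1}}(x)/p_{β_k}(x))`
  — the sum of the exact-weight Metropolis ratios of the two nearest-neighbour level moves, which dominates
  the level-move probability of every Metropolis / Metropolis–Hastings / neighbour-Gibbs level update with
  exact weights (proposal probabilities `≤ 1`); `measurable_stLevelMoveRatio`, `stLevelMoveRatio_nonneg`,
  `stLevelMoveRatio_le_two`.

* **`st_moveRate_le_ladder`** — on the uniform ladder `β_k = a + k(b−a)/K` (`a ≤ b`, `K ≥ 1`) under a variance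
  floor `m ≤ Var_{μ_u}(X)` on `[a, b]`, GEN-11's overlap ceiling gives
  `(2/(K+1))·Σ_{k<K} ∫ min(p_{β_k}, p_{β_{k+1}}) dμ ≤ (2K/(K+1))·exp(−m(b−a)²/(8K²))`.

NOT CLAIMED: a construction of any particular simulated-tempering kernel (the laws downstream quantify over
ALL kernels leaving `stTarget` invariant); estimated (non-exact) weights.  Literature grade (cell rule):
bookkeeping, NEW TYPING; nothing cited as a fact.
-/

noncomputable section

open MeasureTheory ProbabilityTheory Set Filter Finset
open Literature.MathematicalPhysics.QuantumFieldTheory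
open Literature.MathematicalPhysics.QuantumFieldTheory.Luscher2010
open Summit.Ventures.LatticeQCDFlow.Scoring
open Summit.Ventures.LatticeQCDFlow.TrivializingMaps
open scoped ENNReal

namespace Summit.Ventures.LatticeQCDFlow.Scaling

/-! ## §1 The simulated-tempering target with exact weights -/

section Target

variable {Ω : Type*} [MeasurableSpace Ω]

/-- **The simulated-tempering (expanded-ensemble) target with EXACT free-energy weights** over the levels
`β_0, …, β_K`: the probability measure `(K+1)⁻¹·Σ_{k ≤ K} δ_k ⊗ μ_{β_k}` on `Fin (K+1) × Ω`,
`μ_u = μ.tilted(u·X)` — every level equally visited, the configuration at level `k` distributed as `μ_{β_k}`.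
[ours] -/
def stTarget (X : Ω → ℝ) (μ : Measure Ω) (β : ℕ → ℝ) (K : ℕ) : Measure (Fin (K + 1) × Ω) :=
  ((K + 1 : ℕ) : ℝ≥0∞)⁻¹ • ∑ k : Fin (K + 1), (μ.tilted fun x => β k * X x).map (Prod.mk k)

variable {X : Ω → ℝ} {μ : Measure Ω} [IsProbabilityMeasure μ] {β : ℕ → ℝ} {K : ℕ}

omit [IsProbabilityMeasure μ] in
/-- Integration against the simulated-tempering target: `∫ g dπ = (K+1)⁻¹·Σ_k ∫ g(k, x) dμ_{β_k}(x)` for bounded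
measurable `g`. [ours] -/
theorem integral_stTarget {g : Fin (K + 1) × Ω → ℝ} (hgm : Measurable g) {C : ℝ} (hgb : ∀ z, |g z| ≤ C) :
    ∫ z, g z ∂(stTarget X μ β K) =
      1 / (K + 1) * ∑ k : Fin (K + 1), ∫ x, g (k, x) ∂(μ.tilted fun x => β k * X x) := by
  unfold stTarget
  have hint : ∀ k : Fin (K + 1), Integrable g ((μ.tilted fun x => β k * X x).map (Prod.mk k)) := fun k => by
    haveI : IsFiniteMeasure ((μ.tilted fun x => β k * X x).map (Prod.mk k)) :=
      Measure.isFiniteMeasure_map _ _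
    exact Integrable.of_bound hgm.aestronglyMeasurable C (ae_of_all _ fun z => by
      rw [Real.norm_eq_abs]; exact hgb z)
  rw [integral_smul_measure, integral_finsetSum_measure fun k _ => hint k, ENNReal.toReal_inv,
    ENNReal.toReal_natCast, smul_eq_mul]
  push_cast
  rw [← one_div]
  congr 1
  refine Finset.sum_congr rfl fun k _ => ?_
  rw [integral_map measurable_prodMk_left.aemeasurable hgm.aestronglyMeasurable]

/-- The simulated-tempering target is a probability measure. [ours] -/
theorem isProbabilityMeasure_stTarget (hXm : Measurable X) (hXb : ∃ C, ∀ x, |X x| ≤ C) :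
    IsProbabilityMeasure (stTarget X μ β K) := by
  constructor
  have h : ∀ k : Fin (K + 1), (μ.tilted fun x => β k * X x).map (Prod.mk k) univ = 1 := fun k => by
    haveI := isProbabilityMeasure_tilted_mul (μ := μ) hXm hXb (β k)
    rw [Measure.map_apply measurable_prodMk_left MeasurableSet.univ, Set.preimage_univ, measure_univ]
  simp only [stTarget, Measure.smul_apply, Measure.coe_finsetSum, Finset.sum_apply, h, Finset.sum_const,
    Finset.card_univ, Fintype.card_fin, smul_eq_mul, nsmul_eq_mul, mul_one]
  exact ENNReal.inv_mul_cancel (by simp) (ENNReal.natCast_ne_top _)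

/-- The level map `z ↦ z.1` (as a natural number) is measurable. [folklore] -/
theorem measurable_stLevel : Measurable fun z : Fin (K + 1) × Ω => ((z.1 : Fin (K + 1)) : ℕ) :=
  (measurable_of_countable fun j : Fin (K + 1) => (j : ℕ)).comp measurable_fst

/-- **Every level carries mass `1/(K+1)`** under the exact-weight target. [ours] -/
theorem stTarget_real_level (hXm : Measurable X) (hXb : ∃ C, ∀ x, |X x| ≤ C) (k : ℕ) (hk : k ≤ K) :
    (stTarget X μ β K).real {z | ((z.1 : Fin (K + 1)) : ℕ) = k} = 1 / (K + 1) := by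
  have hS : MeasurableSet {z : Fin (K + 1) × Ω | ((z.1 : Fin (K + 1)) : ℕ) = k} :=
    measurable_stLevel (measurableSet_singleton k)
  rw [← integral_indicator_one hS]
  set S : Set (Fin (K + 1) × Ω) := {z : Fin (K + 1) × Ω | ((z.1 : Fin (K + 1)) : ℕ) = k} with hS_def
  have hgm : Measurable (S.indicator (1 : Fin (K + 1) × Ω → ℝ)) := measurable_const.indicator hS
  have hgb : ∀ z, |(S.indicator (1 : Fin (K + 1) × Ω → ℝ)) z| ≤ 1 := fun z => by
    by_cases hz : z ∈ S
    · rw [Set.indicator_of_mem hz]; simp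
    · rw [Set.indicator_of_notMem hz]; simp
  rw [integral_stTarget hgm hgb]
  have e : ∀ j : Fin (K + 1), ∫ x, S.indicator (1 : Fin (K + 1) × Ω → ℝ) (j, x) ∂(μ.tilted fun x => β j * X x) =
      if j = ⟨k, Nat.lt_succ_of_le hk⟩ then 1 else 0 := by
    intro j
    haveI := isProbabilityMeasure_tilted_mul (μ := μ) hXm hXb (β j)
    by_cases hj : j = ⟨k, Nat.lt_succ_of_le hk⟩
    · have hmem : ∀ x : Ω, ((j, x) : Fin (K + 1) × Ω) ∈ S := fun x => by
        rw [hS_def, Set.mem_setOf_eq, hj]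
      simp only [Set.indicator_of_mem (hmem _), Pi.one_apply, integral_const, probReal_univ, smul_eq_mul,
        mul_one, if_pos hj]
    · have hnot : ∀ x : Ω, ((j, x) : Fin (K + 1) × Ω) ∉ S := fun x => by
        rw [hS_def, Set.mem_setOf_eq]
        intro h
        exact hj (Fin.ext h)
      simp only [Set.indicator_of_notMem (hnot _), integral_zero, if_neg hj]
  simp only [e, Finset.sum_ite_eq', Finset.mem_univ, if_true, mul_one]

end Target

/-! ## §2 The exact-weight nearest-neighbour level-move ratios -/

section Ratio

variable {Ω : Type*} [MeasurableSpace Ω]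

/-- **The exact-weight level-move ratios** at `(k, x)`: `1[k<K]·min(1, p_{β_{k+1}}(x)/p_{β_k}(x)) +
1[k≥1]·min(1, p_{β_{k−1}}(x)/p_{β_k}(x))`, `p_u = e^{uX}/mgf(u)` — an upper bound for the probability that an
exact-weight nearest-neighbour Metropolis / Metropolis–Hastings / neighbour-Gibbs level update moves the level
from `(k, x)`. [ours] -/
def stLevelMoveRatio (X : Ω → ℝ) (μ : Measure Ω) (β : ℕ → ℝ) (K : ℕ) (z : Fin (K + 1) × Ω) : ℝ :=
  (if ((z.1 : Fin (K + 1)) : ℕ) < K then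
      min 1 ((Real.exp (β ((z.1 : ℕ) + 1) * X z.2) / mgf X μ (β ((z.1 : ℕ) + 1))) /
        (Real.exp (β (z.1 : ℕ) * X z.2) / mgf X μ (β (z.1 : ℕ))))
    else 0) +
  (if 1 ≤ ((z.1 : Fin (K + 1)) : ℕ) then
      min 1 ((Real.exp (β ((z.1 : ℕ) - 1) * X z.2) / mgf X μ (β ((z.1 : ℕ) - 1))) /
        (Real.exp (β (z.1 : ℕ) * X z.2) / mgf X μ (β (z.1 : ℕ))))
    else 0)

variable {X : Ω → ℝ} {μ : Measure Ω} {β : ℕ → ℝ} {K : ℕ}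

/-- The level-move ratio is measurable (for measurable `X`). [ours] -/
theorem measurable_stLevelMoveRatio (hXm : Measurable X) : Measurable (stLevelMoveRatio X μ β K) := by
  refine measurable_from_prod_countable_right fun k => ?_
  have hp : ∀ u : ℝ, Measurable fun x : Ω => Real.exp (u * X x) / mgf X μ u := fun u =>
    (Real.measurable_exp.comp (hXm.const_mul u)).div_const _
  unfold stLevelMoveRatio
  refine Measurable.add ?_ ?_
  · by_cases hk : ((k : Fin (K + 1)) : ℕ) < K
    · simp only [hk, if_true]
      exact measurable_const.min ((hp _).div (hp _))
    · simp only [hk, if_false]; exact measurable_const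
  · by_cases hk : 1 ≤ ((k : Fin (K + 1)) : ℕ)
    · simp only [hk, if_true]
      exact measurable_const.min ((hp _).div (hp _))
    · simp only [hk, if_false]; exact measurable_const

/-- The level-move ratio is nonnegative. [ours] -/
theorem stLevelMoveRatio_nonneg [IsProbabilityMeasure μ] (hXm : Measurable X) (hXb : ∃ C, ∀ x, |X x| ≤ C)
    (z : Fin (K + 1) × Ω) : 0 ≤ stLevelMoveRatio X μ β K z := by
  unfold stLevelMoveRatio
  refine add_nonneg ?_ ?_ <;> split_ifs
  · exact le_min zero_le_one (div_nonneg (div_nonneg (Real.exp_pos _).le (mgf_pos_of_bounded hXm hXb _).le)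
      (div_nonneg (Real.exp_pos _).le (mgf_pos_of_bounded hXm hXb _).le))
  · exact le_rfl
  · exact le_min zero_le_one (div_nonneg (div_nonneg (Real.exp_pos _).le (mgf_pos_of_bounded hXm hXb _).le)
      (div_nonneg (Real.exp_pos _).le (mgf_pos_of_bounded hXm hXb _).le))
  · exact le_rfl

/-- The level-move ratio is at most `2`. [ours] -/
theorem stLevelMoveRatio_le_two (z : Fin (K + 1) × Ω) : stLevelMoveRatio X μ β K z ≤ 2 := by
  unfold stLevelMoveRatio
  have h1 : ∀ (c : Prop) [Decidable c] (t : ℝ), (if c then min 1 t else 0) ≤ 1 := fun c _ t => by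
    split_ifs
    · exact min_le_left _ _
    · exact zero_le_one
  linarith [h1 (((z.1 : Fin (K + 1)) : ℕ) < K) ((Real.exp (β ((z.1 : ℕ) + 1) * X z.2) /
      mgf X μ (β ((z.1 : ℕ) + 1))) / (Real.exp (β (z.1 : ℕ) * X z.2) / mgf X μ (β (z.1 : ℕ)))),
    h1 (1 ≤ ((z.1 : Fin (K + 1)) : ℕ)) ((Real.exp (β ((z.1 : ℕ) - 1) * X z.2) /
      mgf X μ (β ((z.1 : ℕ) - 1))) / (Real.exp (β (z.1 : ℕ) * X z.2) / mgf X μ (β (z.1 : ℕ))))]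

end Ratio

/-! ## §3 Adjacent overlaps on a uniform ladder under a variance floor -/

section Ladder

variable {Ω : Type*} [MeasurableSpace Ω] {X : Ω → ℝ} {μ : Measure Ω} [IsProbabilityMeasure μ] {K : ℕ}

/-- **Adjacent overlaps on a uniform ladder under a variance floor**: with `β_k = a + k(b−a)/K`, `a ≤ b`,
`K ≥ 1` and `m ≤ Var_{μ_u}(X)` on `[a,b]`, every adjacent overlap is `≤ exp(−m(b−a)²/(8K²))`, so
`ā_K ≤ (2K/(K+1))·exp(−m(b−a)²/(8K²))`. [ours] -/
theorem st_moveRate_le_ladder (hXm : Measurable X) (hXb : ∃ C, ∀ x, |X x| ≤ C) {a b m : ℝ} (hab : a ≤ b)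
    (hK : 1 ≤ K) (hm : ∀ u ∈ Icc a b, m ≤ variance X (μ.tilted fun x => u * X x)) :
    2 / (K + 1) * ∑ k ∈ range K, ∫ x, min (Real.exp ((a + k * ((b - a) / K)) * X x) /
          mgf X μ (a + k * ((b - a) / K)))
        (Real.exp ((a + (k + 1 : ℕ) * ((b - a) / K)) * X x) / mgf X μ (a + (k + 1 : ℕ) * ((b - a) / K))) ∂μ ≤
      2 * K / (K + 1) * Real.exp (-(m * (b - a) ^ 2 / (8 * K ^ 2))) := by
  have hKr : (1 : ℝ) ≤ K := by exact_mod_cast hK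
  have hK0 : (0 : ℝ) < K := by linarith
  have hδ : 0 ≤ (b - a) / K := div_nonneg (sub_nonneg.2 hab) hK0.le
  have hstep : ∀ k ∈ range K, ∫ x, min (Real.exp ((a + k * ((b - a) / K)) * X x) /
        mgf X μ (a + k * ((b - a) / K)))
      (Real.exp ((a + (k + 1 : ℕ) * ((b - a) / K)) * X x) / mgf X μ (a + (k + 1 : ℕ) * ((b - a) / K))) ∂μ ≤
      Real.exp (-(m * (b - a) ^ 2 / (8 * K ^ 2))) := by
    intro k hk
    have hkK : (k : ℝ) + 1 ≤ K := by exact_mod_cast Finset.mem_range.1 hk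
    have hs : a ≤ a + k * ((b - a) / K) := le_add_of_nonneg_right (mul_nonneg (Nat.cast_nonneg _) hδ)
    have hst : a + k * ((b - a) / K) ≤ a + (k + 1 : ℕ) * ((b - a) / K) := by
      push_cast; nlinarith
    have ht : a + (k + 1 : ℕ) * ((b - a) / K) ≤ b := by
      push_cast
      have : ((k : ℝ) + 1) * ((b - a) / K) ≤ K * ((b - a) / K) := mul_le_mul_of_nonneg_right hkK hδ
      rw [mul_div_cancel₀ _ hK0.ne'] at this
      linarith
    refine (overlap_le_exp_neg_floor hXm hXb hst fun u hu => hm u ⟨hs.trans hu.1, hu.2.trans ht⟩).trans ?_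
    apply Real.exp_le_exp.2
    have e : a + (k + 1 : ℕ) * ((b - a) / K) - (a + k * ((b - a) / K)) = (b - a) / K := by push_cast; ring
    rw [e, div_pow]
    apply neg_le_neg
    apply le_of_eq
    field_simp
  calc 2 / (K + 1) * ∑ k ∈ range K, ∫ x, min (Real.exp ((a + k * ((b - a) / K)) * X x) /
          mgf X μ (a + k * ((b - a) / K)))
        (Real.exp ((a + (k + 1 : ℕ) * ((b - a) / K)) * X x) / mgf X μ (a + (k + 1 : ℕ) * ((b - a) / K))) ∂μ
      ≤ 2 / (K + 1) * ∑ _k ∈ range K, Real.exp (-(m * (b - a) ^ 2 / (8 * K ^ 2))) := by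
        gcongr with k hk
        exact hstep k hk
    _ = 2 * K / (K + 1) * Real.exp (-(m * (b - a) ^ 2 / (8 * K ^ 2))) := by
        rw [Finset.sum_const, Finset.card_range, nsmul_eq_mul]; ring

end Ladder

end Summit.Ventures.LatticeQCDFlow.Scaling

end
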